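import Summits.CriticalPhenomena.PercolationContinuityZ3.Theorems.PercNearOneGluingNoHeavyQuantClusterPartition
import Literature.Probability.Percolation.GhostFieldMagnetizationClusterGF
import Literature.Probability.Percolation.BondPercolationSymmetry
import Literature.NumberTheory.EllipticCurves.TateSeriesGrowth
import HarnessLib

/-!
# The Aizenman–Barsky quantities of the box `Λ_n` read on `ℤ^d`: `θ^{Λ_n}_y(p,γ)`, `γ∂θ^{Λ_n}/∂γ`, `(1-γ)∂θ^{Λ_n}/∂γ` as
# `ℤ^d`-expectations of functions of `|C_{Λ_n}(y)|`, their limits along `Λ_n ↑ ℤ^d`, and the domination `θ^{Λ_n}_y ≤ M(p,γ)` —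
# quant lane, seat p4 gen 6

builds on p205010 (kernel theorem, internal audit signed; external expert review pending).
Status sentence for p205010: "θ(p_c) = 0 on ℤ^d, all d ≥ 2 — kernel-verified (Lean 4/Mathlib, standard axioms); internal
adversarial audit SIGNED 2026-08-20 04:29Z; external expert review pending."

Seat `prim-quant-p4`, `--supports stmt-CriticalPhenomena-4575`; pure proofs, no definitions.  Notation: `P_p = bondPercolation (zdGraph d) p`,
`C_{Λ_n}(y)` = the open cluster of `y` using only the edges inside `Λ_n = box d n` (the restriction coupling `restrictConfig Subtype.val`;
the induced graph is `(zdGraph d).comap Subtype.val`), `M(p,γ) = E_p[1 - (1-γ)^{|C(0)|}] = 1 - Z_p(1-γ)` the magnetization.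

* `ChiF.sum_clusterIs_box_eq_integral` — `Σ_S F(|S|) P^{Λ_n}_p(C(x) = S) = E_p[F(|C_{Λ_n}(x)|)]` (`bondPercolation_map_comap`).
* `ChiF.tendsto_integral_box_clusterFn'` — for `φ` bounded with `φ(k) → c`: `E_p[φ(|C_{Λ_n}(0)|)] → c·θ(p) + Σ_S φ(|S|) P_p(C(0) = S)`
  (dominated convergence along the exhaustion of the previous file).
* §4 the three functions `1-(1-γ)^k`, `kγ(1-γ)^{k-1}`, `k(1-γ)^k`: bounds `1`, `1`, `1/γ` and limits `1`, `0`, `0`.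
* §5 `ChiF.mag_boxGraph_eq_integral`, `one_sub_mul_dGamma_boxGraph_eq_integral`, `mul_dGamma_boxGraph_eq_integral` — Grimmett's
  `θ_N`, `(1-γ)∂θ_N/∂γ = χ_N` ((5.62)–(5.63)) and `γ∂θ_N/∂γ = P(|C_N ∩ G| = 1)` ((5.69)) for the FREE box, as `ℤ^d`-expectations of the
  three functions of `|C_{Λ_n}(y)|` (from the tree's `GhostField.mag_eq_one_sub_clusterGF`, `GhostField.one_sub_mul_dGamma_eq_sum`);
  `ChiF.integral_clusterFn_shift` (translation invariance, `bondPercolation_map_shift`); and **`ChiF.mag_boxGraph_le`**: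
  `θ^{Λ_n}_y(p,γ) ≤ M(p,γ)` for every vertex `y` of the box — the replacement, for free boxes, of Grimmett's use of the symmetry of
  the torus ("`P(A_y) = θ_N`", p. 111); `ChiF.maxDegree_boxGraph_le` (`Δ ≤ 2d`).

Folklore-level finite-volume bookkeeping; nothing here is a rate.

## References
* G. Grimmett, *Percolation*, 2nd ed. (1999), §5.3 (5.59)–(5.69), pp. 108–113 [GrimmettPercolation1999].
* M. Aizenman, D. J. Barsky, Comm. Math. Phys. 108 (1987) 489–526, §2 (finite-volume quantities `M_L`, Prop. 2.3) [AizenmanBarsky1987].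
-/

noncomputable section

namespace Summit.CriticalPhenomena.PercolationContinuityZ3.Theorems

open MeasureTheory Set Filter Topology Literature.Probability.Percolation Literature.Probability.LatticeModels
open scoped Classical ENNReal

namespace ChiF

section Transfer

variable {d : ℕ}

/-- **Finite-graph expectations computed on `ℤ^d`.**  For the subgraph of `ℤ^d` induced on the box `Λ_n`
(`(zdGraph d).comap Subtype.val`), `Σ_S F(|S|) P^{Λ_n}_p(C(x) = S) = E_p[F(|C_{Λ_n}(x)|)]`, where `C_{Λ_n}(x)` is the
cluster of `x` in the configuration restricted to the edges inside `Λ_n` (the restriction coupling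
`bondPercolation_map_comap`). -/
theorem sum_clusterIs_box_eq_integral (p : unitInterval) (n : ℕ) (x : (↑(box d n) : Set (Site d))) (F : ℕ → ℝ) :
    ∑ S : Finset (↑(box d n) : Set (Site d)),
        F S.card * (bondPercolation ((zdGraph d).comap (Subtype.val : (↑(box d n) : Set (Site d)) → Site d)) p).real
          (clusterIs x S) =
      ∫ ω, F (openCluster (restrictConfig (Subtype.val : (↑(box d n) : Set (Site d)) → Site d) ω) x).ncard
        ∂(bondPercolation (zdGraph d) p) := by
  rw [← integral_clusterFn_fintype, ← bondPercolation_map_comap (zdGraph d) Subtype.val_injective p,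
    integral_map (measurable_restrictConfig _).aemeasurable (measurable_of_fintype_config _).aestronglyMeasurable]

/-- **Dominated convergence along the boxes.**  For `φ : ℕ → ℝ` bounded with `φ(k) → c`,
`E_p[φ(|C_{Λ_n}(0)|)] → E_p[F]` where `F = φ(|C(0)|)` on `{|C(0)| < ∞}` and `F = c` on `{|C(0)| = ∞}`
(the `Λ_n`-cluster of `0` increases to `C(0)`: it equals `C(0)` eventually if `C(0)` is finite, and its size tends to
infinity otherwise). -/
theorem tendsto_integral_box_clusterFn (p : unitInterval) {φ : ℕ → ℝ} {B c : ℝ} (hφ : ∀ k, |φ k| ≤ B)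
    (hlim : Tendsto φ atTop (𝓝 c)) :
    Tendsto (fun n : ℕ => ∫ ω, φ (openCluster (restrictConfig (Subtype.val : (↑(box d n) : Set (Site d)) → Site d) ω)
        ⟨0, by exact_mod_cast zero_mem_box d n⟩).ncard ∂(bondPercolation (zdGraph d) p)) atTop
      (𝓝 (∫ ω, (if (openCluster ω 0).Finite then φ (openCluster ω 0).ncard else c) ∂(bondPercolation (zdGraph d) p))) := by
  refine tendsto_integral_of_dominated_convergence (fun _ => max B |c|) (fun n => ?_) (integrable_const _)
    (fun n => Eventually.of_forall fun ω => ?_) (Eventually.of_forall fun ω => ?_)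
  · exact ((measurable_of_fintype_config (W := (↑(box d n) : Set (Site d)))
      (fun ξ => φ (openCluster ξ ⟨0, by exact_mod_cast zero_mem_box d n⟩).ncard)).comp
      (measurable_restrictConfig _)).aestronglyMeasurable
  · rw [Real.norm_eq_abs]; exact (hφ _).trans (le_max_left _ _)
  · by_cases hfin : (openCluster ω 0).Finite
    · simp only [hfin, if_true]
      refine tendsto_const_nhds.congr' ?_
      filter_upwards [eventually_image_openCluster_restrict_eq hfin] with n hn
      rw [← hn, Set.ncard_image_of_injective _ Subtype.val_injective]
    · simp only [hfin, if_false]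
      exact hlim.comp (tendsto_ncard_openCluster_restrict_atTop hfin)

/-- The limit identified: `E_p[φ(|C_{Λ_n}(0)|)] → c θ(p) + Σ_S φ(|S|) P_p(C(0) = S)`. -/
theorem tendsto_integral_box_clusterFn' (p : unitInterval) {φ : ℕ → ℝ} {B c : ℝ} (hφ : ∀ k, |φ k| ≤ B)
    (hlim : Tendsto φ atTop (𝓝 c)) :
    Tendsto (fun n : ℕ => ∫ ω, φ (openCluster (restrictConfig (Subtype.val : (↑(box d n) : Set (Site d)) → Site d) ω)
        ⟨0, by exact_mod_cast zero_mem_box d n⟩).ncard ∂(bondPercolation (zdGraph d) p)) atTop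
      (𝓝 (c * theta (zdGraph d) 0 p +
        ∑' S : Finset (Site d), φ S.card * (bondPercolation (zdGraph d) p).real (clusterIs 0 S))) := by
  have h := hasSum_integral_clusterFn (zdGraph d) (0 : Site d) p hφ c
  rw [h.tsum_eq, add_sub_cancel]
  exact tendsto_integral_box_clusterFn p hφ hlim

end Transfer

/-! ### §4. The three functions of `|C|`: `1 - (1-γ)^k`, `k γ (1-γ)^{k-1}`, `k (1-γ)^k` -/

section Gamma

/-- `k γ (1-γ)^{k-1} ≤ 1` for `γ ∈ [0,1]`. -/
theorem mul_mul_pow_pred_le_one {γ : ℝ} (h0 : 0 ≤ γ) (h1 : γ ≤ 1) (k : ℕ) :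
    (k : ℝ) * γ * (1 - γ) ^ (k - 1) ≤ 1 := by
  rcases k with _ | k
  · simp
  · have h := Literature.NumberTheory.EllipticCurves.succ_mul_pow_mul_one_sub_le (x := 1 - γ) (by linarith) (by linarith) k
    have : (1 - γ) ^ (k + 1) ≥ 0 := pow_nonneg (by linarith) _
    simp only [Nat.cast_succ, Nat.add_sub_cancel]
    nlinarith

/-- `k (1-γ)^k ≤ 1/γ` for `γ ∈ (0,1]`. -/
theorem mul_pow_le_inv {γ : ℝ} (h0 : 0 < γ) (h1 : γ ≤ 1) (k : ℕ) :
    (k : ℝ) * (1 - γ) ^ k ≤ 1 / γ := by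
  rw [le_div_iff₀ h0]
  rcases k with _ | k
  · simp
  · have h := mul_mul_pow_pred_le_one h0.le h1 (k + 1)
    have h' : ((k : ℝ) + 1) * γ * (1 - γ) ^ k ≤ 1 := by simpa using h
    have hg : 0 ≤ 1 - γ := by linarith
    calc ((↑(k + 1) : ℝ)) * (1 - γ) ^ (k + 1) * γ = (((k : ℝ) + 1) * γ * (1 - γ) ^ k) * (1 - γ) := by
          push_cast; ring
      _ ≤ 1 * (1 - γ) := by gcongr
      _ ≤ 1 := by linarith

/-- `0 ≤ 1 - (1-γ)^k ≤ 1`. -/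
theorem abs_one_sub_pow_le {γ : ℝ} (h0 : 0 ≤ γ) (h1 : γ ≤ 1) (k : ℕ) : |1 - (1 - γ) ^ k| ≤ 1 := by
  have h2 : (1 - γ) ^ k ≤ 1 := pow_le_one₀ (by linarith) (by linarith)
  have h3 : 0 ≤ (1 - γ) ^ k := pow_nonneg (by linarith) _
  rw [abs_le]; constructor <;> linarith

/-- `|k γ (1-γ)^{k-1}| ≤ 1`. -/
theorem abs_mul_mul_pow_pred_le {γ : ℝ} (h0 : 0 ≤ γ) (h1 : γ ≤ 1) (k : ℕ) :
    |(k : ℝ) * γ * (1 - γ) ^ (k - 1)| ≤ 1 := by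
  rw [abs_of_nonneg (by positivity)]
  · exact mul_mul_pow_pred_le_one h0 h1 k

/-- `|k (1-γ)^k| ≤ 1/γ`. -/
theorem abs_mul_pow_le {γ : ℝ} (h0 : 0 < γ) (h1 : γ ≤ 1) (k : ℕ) : |(k : ℝ) * (1 - γ) ^ k| ≤ 1 / γ := by
  rw [abs_of_nonneg (mul_nonneg (Nat.cast_nonneg _) (pow_nonneg (by linarith) _))]
  exact mul_pow_le_inv h0 h1 k

/-- `1 - (1-γ)^k → 1`. -/
theorem tendsto_one_sub_pow {γ : ℝ} (h0 : 0 < γ) (h1 : γ ≤ 1) :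
    Tendsto (fun k : ℕ => 1 - (1 - γ) ^ k) atTop (𝓝 1) := by
  have h : Tendsto (fun k : ℕ => (1 - γ) ^ k) atTop (𝓝 0) :=
    tendsto_pow_atTop_nhds_zero_of_lt_one (by linarith) (by linarith)
  simpa using tendsto_const_nhds.sub h

/-- `k (1-γ)^k → 0`. -/
theorem tendsto_mul_pow {γ : ℝ} (h0 : 0 < γ) (h1 : γ ≤ 1) :
    Tendsto (fun k : ℕ => (k : ℝ) * (1 - γ) ^ k) atTop (𝓝 0) :=
  tendsto_self_mul_const_pow_of_abs_lt_one (by rw [abs_of_nonneg (by linarith)]; linarith)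

/-- `k γ (1-γ)^{k-1} → 0`. -/
theorem tendsto_mul_mul_pow_pred {γ : ℝ} (h0 : 0 < γ) (h1 : γ < 1) :
    Tendsto (fun k : ℕ => (k : ℝ) * γ * (1 - γ) ^ (k - 1)) atTop (𝓝 0) := by
  have hA := tendsto_mul_pow h0 h1.le
  have hB : Tendsto (fun k : ℕ => (1 - γ) ^ k) atTop (𝓝 0) :=
    tendsto_pow_atTop_nhds_zero_of_lt_one (by linarith) (by linarith)
  have h3 : Tendsto (fun j : ℕ => γ * ((j : ℝ) * (1 - γ) ^ j) + γ * (1 - γ) ^ j) atTop (𝓝 (γ * 0 + γ * 0)) :=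
    (hA.const_mul γ).add (hB.const_mul γ)
  rw [mul_zero, add_zero] at h3
  rw [← Filter.tendsto_add_atTop_iff_nat 1]
  refine h3.congr fun j => ?_
  simp only [Nat.add_sub_cancel, Nat.cast_add, Nat.cast_one]
  ring

end Gamma

end ChiF

namespace ChiF

/-! ### §5. The Aizenman–Barsky inequalities on the box `Λ_n`, read on `ℤ^d` -/

section BoxGraph

variable {d : ℕ}

/-- Every vertex of the induced box graph has degree at most `2d`. -/
theorem degree_boxGraph_le (n : ℕ) (y : (↑(box d n) : Set (Site d))) :
    ((zdGraph d).comap (Subtype.val : (↑(box d n) : Set (Site d)) → Site d)).degree y ≤ 2 * d := by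
  classical
  rw [← card_neighborFinset_zdGraph_holds (y : Site d), ← SimpleGraph.card_neighborFinset_eq_degree]
  refine Finset.card_le_card_of_injOn Subtype.val (fun z hz => ?_) (Set.injOn_of_injective Subtype.val_injective)
  rw [Finset.mem_coe, SimpleGraph.mem_neighborFinset] at hz ⊢
  exact hz

/-- The induced box graph has maximal degree at most `2d`. -/
theorem maxDegree_boxGraph_le (n : ℕ) :
    ((zdGraph d).comap (Subtype.val : (↑(box d n) : Set (Site d)) → Site d)).maxDegree ≤ 2 * d := by
  classical
  exact SimpleGraph.maxDegree_le_of_forall_degree_le _ _ fun y => degree_boxGraph_le n y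

/-- Translation invariance of `E_p[F(|C(y)|)]` on `ℤ^d` (for functions extended by a constant on infinite clusters). -/
theorem integral_clusterFn_shift (p : unitInterval) (φ : ℕ → ℝ) (c : ℝ) (y : Site d) :
    ∫ ω, (if (openCluster ω y).Finite then φ (openCluster ω y).ncard else c) ∂(bondPercolation (zdGraph d) p) =
      ∫ ω, (if (openCluster ω 0).Finite then φ (openCluster ω 0).ncard else c) ∂(bondPercolation (zdGraph d) p) := by
  set e : Site d ≃ Site d := Site.shift y with he
  set R := BondConfig.relabel (sym2Equiv e) with hR
  -- the cluster of `y = e 0` in the shifted configuration is the shift of the cluster of `0`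
  have hreach : ∀ (ω : BondConfig (Site d)) (a b : Site d),
      (openGraph (R ω)).Reachable (e a) (e b) ↔ (openGraph ω).Reachable a b := by
    intro ω a b
    let ψ : openGraph ω ≃g openGraph (R ω) :=
      { toEquiv := e, map_rel_iff' := fun {u v} => openGraph_relabel_adj_iff e ω u v }
    constructor
    · intro h
      have := h.map ψ.symm.toHom
      simpa [ψ] using this
    · intro h; exact h.map ψ.toHom
  have hcl : ∀ ω : BondConfig (Site d), openCluster (R ω) y = e '' openCluster ω 0 := by
    intro ω
    have he0 : e 0 = y := by simp [he]
    ext w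
    simp only [openCluster, Set.mem_setOf_eq, Set.mem_image]
    constructor
    · intro hw
      refine ⟨e.symm w, ?_, e.apply_symm_apply w⟩
      have hw' : (openGraph (R ω)).Reachable (e 0) (e (e.symm w)) := by rwa [e.apply_symm_apply, he0]
      exact (hreach ω 0 _).1 hw'
    · rintro ⟨z, hz, rfl⟩
      have := (hreach ω 0 z).2 hz
      rwa [he0] at this
  have hcomp : (fun ω : BondConfig (Site d) => if (openCluster ω y).Finite then φ (openCluster ω y).ncard else c) ∘ R =
      fun ω => if (openCluster ω 0).Finite then φ (openCluster ω 0).ncard else c := by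
    funext ω
    simp only [Function.comp_apply, hcl ω, Set.finite_image_iff e.injective.injOn,
      Set.ncard_image_of_injective _ e.injective]
  calc ∫ ω, (if (openCluster ω y).Finite then φ (openCluster ω y).ncard else c) ∂(bondPercolation (zdGraph d) p)
      = ∫ ω, (if (openCluster ω y).Finite then φ (openCluster ω y).ncard else c)
          ∂((bondPercolation (zdGraph d) p).map R) := by rw [hR, he, bondPercolation_map_shift]
    _ = ∫ ω, ((fun ω : BondConfig (Site d) => if (openCluster ω y).Finite then φ (openCluster ω y).ncard else c) ∘ R) ω
          ∂(bondPercolation (zdGraph d) p) :=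
        integral_map R.measurable.aemeasurable (measurable_clusterFn y φ c).aestronglyMeasurable
    _ = _ := by rw [hcomp]

variable (p γ : unitInterval) (n : ℕ)

/-- The magnetization of the box graph at `y`, computed on `ℤ^d`: `θ^{Λ_n}_y(p,γ) = E_p[1 - (1-γ)^{|C_{Λ_n}(y)|}]`. -/
theorem mag_boxGraph_eq_integral (y : (↑(box d n) : Set (Site d))) :
    GhostField.mag ((zdGraph d).comap (Subtype.val : (↑(box d n) : Set (Site d)) → Site d)) p γ y =
      ∫ ω, (1 - (1 - (γ : ℝ)) ^ (openCluster (restrictConfig (Subtype.val : (↑(box d n) : Set (Site d)) → Site d) ω) y).ncard)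
        ∂(bondPercolation (zdGraph d) p) := by
  classical
  rw [GhostField.mag_eq_one_sub_clusterGF, clusterGF, tsum_fintype,
    ← sum_clusterIs_box_eq_integral p n y (fun k => 1 - (1 - (γ : ℝ)) ^ k)]
  have h1 := sum_clusterIs_box_eq_integral p n y (fun _ => (1 : ℝ))
  simp only [one_mul, integral_const, smul_eq_mul, mul_one, probReal_univ] at h1
  calc 1 - ∑ S : Finset (↑(box d n) : Set (Site d)),
        (bondPercolation ((zdGraph d).comap (Subtype.val : (↑(box d n) : Set (Site d)) → Site d)) p).real (clusterIs y S) *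
          (1 - (γ : ℝ)) ^ S.card
      = ∑ S : Finset (↑(box d n) : Set (Site d)),
          (bondPercolation ((zdGraph d).comap (Subtype.val : (↑(box d n) : Set (Site d)) → Site d)) p).real (clusterIs y S) -
        ∑ S : Finset (↑(box d n) : Set (Site d)),
          (bondPercolation ((zdGraph d).comap (Subtype.val : (↑(box d n) : Set (Site d)) → Site d)) p).real (clusterIs y S) *
            (1 - (γ : ℝ)) ^ S.card := by rw [h1]
    _ = _ := by
        rw [← Finset.sum_sub_distrib]
        exact Finset.sum_congr rfl fun S _ => by ring

/-- `(1-γ) ∂θ^{Λ_n}_y/∂γ = E_p[|C_{Λ_n}(y)| (1-γ)^{|C_{Λ_n}(y)|}]` (Grimmett (5.62)–(5.63) on the box, read on `ℤ^d`). -/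
theorem one_sub_mul_dGamma_boxGraph_eq_integral (y : (↑(box d n) : Set (Site d))) :
    (1 - (γ : ℝ)) * GhostField.dGamma (G := (zdGraph d).comap (Subtype.val : (↑(box d n) : Set (Site d)) → Site d)) p γ y =
      ∫ ω, ((openCluster (restrictConfig (Subtype.val : (↑(box d n) : Set (Site d)) → Site d) ω) y).ncard : ℝ) *
          (1 - (γ : ℝ)) ^ (openCluster (restrictConfig (Subtype.val : (↑(box d n) : Set (Site d)) → Site d) ω) y).ncard
        ∂(bondPercolation (zdGraph d) p) := by
  classical
  rw [GhostField.one_sub_mul_dGamma_eq_sum,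
    ← sum_clusterIs_box_eq_integral p n y (fun k => (k : ℝ) * (1 - (γ : ℝ)) ^ k)]
  refine Finset.sum_congr rfl fun S _ => by ring

/-- `γ ∂θ^{Λ_n}_y/∂γ = E_p[|C_{Λ_n}(y)| γ (1-γ)^{|C_{Λ_n}(y)| - 1}]` (`= P(|C ∩ G_N| = 1)`, Grimmett (5.69)), for `γ < 1`. -/
theorem mul_dGamma_boxGraph_eq_integral (hγ1 : (γ : ℝ) < 1) (y : (↑(box d n) : Set (Site d))) :
    (γ : ℝ) * GhostField.dGamma (G := (zdGraph d).comap (Subtype.val : (↑(box d n) : Set (Site d)) → Site d)) p γ y =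
      ∫ ω, ((openCluster (restrictConfig (Subtype.val : (↑(box d n) : Set (Site d)) → Site d) ω) y).ncard : ℝ) * (γ : ℝ) *
          (1 - (γ : ℝ)) ^ ((openCluster (restrictConfig (Subtype.val : (↑(box d n) : Set (Site d)) → Site d) ω) y).ncard - 1)
        ∂(bondPercolation (zdGraph d) p) := by
  classical
  have ht : (1 - (γ : ℝ)) ≠ 0 := by linarith
  have hkey : ∀ k : ℕ, ((γ : ℝ) / (1 - γ)) * ((k : ℝ) * (1 - (γ : ℝ)) ^ k) = (k : ℝ) * γ * (1 - (γ : ℝ)) ^ (k - 1) := by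
    intro k
    rcases k with _ | k
    · simp
    · simp only [Nat.add_sub_cancel, pow_succ]
      field_simp
  calc (γ : ℝ) * GhostField.dGamma (G := (zdGraph d).comap (Subtype.val : (↑(box d n) : Set (Site d)) → Site d)) p γ y
      = ((γ : ℝ) / (1 - γ)) * ((1 - (γ : ℝ)) *
          GhostField.dGamma (G := (zdGraph d).comap (Subtype.val : (↑(box d n) : Set (Site d)) → Site d)) p γ y) := by
        field_simp
    _ = _ := by
        rw [one_sub_mul_dGamma_boxGraph_eq_integral, ← integral_const_mul]
        refine integral_congr_ae (Eventually.of_forall fun ω => hkey _)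

/-- **Domination of the box magnetization by the infinite-volume one**: for every vertex `y` of `Λ_n`,
`θ^{Λ_n}_y(p,γ) ≤ M(p,γ) := E_p[1 - (1-γ)^{|C(0)|}]` (the `Λ_n`-cluster of `y` embeds in `C(y)`, `k ↦ 1-(1-γ)^k` is
monotone, and `P_p` is translation invariant). -/
theorem mag_boxGraph_le (y : (↑(box d n) : Set (Site d))) :
    GhostField.mag ((zdGraph d).comap (Subtype.val : (↑(box d n) : Set (Site d)) → Site d)) p γ y ≤
      ∫ ω, (if (openCluster ω 0).Finite then 1 - (1 - (γ : ℝ)) ^ (openCluster ω 0).ncard else 1)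
        ∂(bondPercolation (zdGraph d) p) := by
  have hγ0 : 0 ≤ (γ : ℝ) := γ.2.1
  have hγ1 : (γ : ℝ) ≤ 1 := γ.2.2
  rw [mag_boxGraph_eq_integral, ← integral_clusterFn_shift p (fun k => 1 - (1 - (γ : ℝ)) ^ k) 1 (y : Site d)]
  refine integral_mono_of_nonneg (Eventually.of_forall fun ω => ?_)
    (integrable_clusterFn (zdGraph d) (y : Site d) p (abs_one_sub_pow_le hγ0 hγ1) 1) (Eventually.of_forall fun ω => ?_)
  · have : (1 - (γ : ℝ)) ^ (openCluster (restrictConfig (Subtype.val : (↑(box d n) : Set (Site d)) → Site d) ω) y).ncard ≤ 1 :=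
      pow_le_one₀ (by linarith) (by linarith)
    simp only [Pi.zero_apply]; linarith
  · simp only
    split_ifs with hfin
    · have hsub := image_openCluster_restrict_subset n ω y
      have hle : (openCluster (restrictConfig (Subtype.val : (↑(box d n) : Set (Site d)) → Site d) ω) y).ncard ≤
          (openCluster ω (y : Site d)).ncard := by
        rw [← Set.ncard_image_of_injective _ Subtype.val_injective]
        exact Set.ncard_le_ncard hsub hfin
      have := pow_le_pow_of_le_one (a := 1 - (γ : ℝ)) (by linarith) (by linarith) hle
      linarith
    · have : 0 ≤ (1 - (γ : ℝ)) ^ (openCluster (restrictConfig (Subtype.val : (↑(box d n) : Set (Site d)) → Site d) ω) y).ncard :=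
        pow_nonneg (by linarith) _
      linarith

end BoxGraph

end ChiF

end Summit.CriticalPhenomena.PercolationContinuityZ3.Theorems
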